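import Literature.Combinatorics.LorentzianPolynomials.StableQuadratic
import Mathlib.Topology.Algebra.MvPolynomial
import HarnessLib

/-!
# `c`-Rayleigh polynomials; Lorentzian quadratic forms are `1`-Rayleigh; Prop. 2.19 from the Hodge–Riemann relations
# (Brändén–Huh 2020, §2.4 Def. 2.18, Prop. 2.17, Prop. 2.19 — unconditionally in degree `≤ 2`)

Layer `Literature/Combinatorics/LorentzianPolynomials`, namespace `Literature.Combinatorics.LorentzianPolynomials`;
lane `lit-hodgefound` (Track 2 foundations library), seat p16, generation 27 (rows g27-#15, §§1–4, and g27-#16, §5). Builds on `StableQuadratic.lean`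
(Euler's formula for quadratics, `eval_nonneg_of_coeff_nonneg`) and on the Lorentz-signature linear algebra of
`Literature.LinearAlgebra.QuadraticForm.LorentzianReverseSchwarz` (`mul_le_sq_of_sigPos_le_one`); the `1`-Rayleigh
conclusion is also spelled with the tree's Rayleigh difference `Literature.Combinatorics.StablePolynomials.rayleighDiff`
(Brändén 2007).

## Source (verbatim) — P. Brändén, J. Huh, *Lorentzian polynomials* [BrandenHuh2019] (held `paper:arxiv-1902.03719`)

§2.4: "Let `c` be a fixed positive real number, and let `f` be a polynomial in `ℝ[w_1,…,w_n]`. In this section, the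
polynomial `f` is not necessarily homogeneous. […] **Definition 2.18.** We say that `f` is `c`-Rayleigh if `f` has
nonnegative coefficients and `∂^α f(w) ∂^{α+e_i+e_j} f(w) ≤ c ∂^{α+e_i} f(w) ∂^{α+e_j} f(w)` for all `i, j ∈ [n]`,
`α ∈ ℕ^n`, `w ∈ ℝ^n_{≥0}`. […] **Proposition 2.19.** Any polynomial in `L^d_n` is `2(1 - 1/d)`-Rayleigh. *Proof.* The
statement follows from Theorem 2.16 and Proposition 2.17 because `2(1 - 1/d)` is an increasing function of `d`."
§2.3, **Proposition 2.17.** "If `𝓗_f(w)` has exactly one positive eigenvalue for all `w ∈ ℝ^n_{>0}`, then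
`f(w) ∂_i∂_j f(w) ≤ 2(1 - 1/d) ∂_i f(w) ∂_j f(w)` for all `w ∈ ℝ^n_{≥0}` and `i, j ∈ [n]`. *Proof.* Fix `w ∈ ℝ^n_{>0}`,
and write `𝓗` for `𝓗_f(w)`. By Euler's formula for homogeneous functions, `w^T 𝓗 w = d(d-1) f(w)` and
`w^T 𝓗 e_i = (d-1) ∂_i f(w)`. Let `t` be a real parameter, and consider the restriction of `𝓗` to the plane spanned by
`w` and `v_t = e_i + t e_j`. […] by Cauchy's interlacing theorem, the restriction of `𝓗` also has exactly one positive
eigenvalue. In particular, the determinant of the restriction must be nonpositive: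
`(w^T 𝓗 v_t)^2 - (w^T 𝓗 w)(v_t^T 𝓗 v_t) ≥ 0` for all `t ∈ ℝ`. In other words, for all `t ∈ ℝ`, we have
`(d-1)^2 (∂_i f + t ∂_j f)^2 - d(d-1) f (∂_i^2 f + 2t ∂_i∂_j f + t^2 ∂_j^2 f) ≥ 0`. It follows that, for all `t ∈ ℝ`,
we have `(d-1)^2 (∂_i f + t ∂_j f)^2 - 2td(d-1) f ∂_i∂_j f ≥ 0`. Thus, the discriminant of the above quadratic polynomial
in `t` should be nonpositive: `f ∂_i∂_j f - 2(1 - 1/d) ∂_i f ∂_j f ≤ 0`." (`f` there is "a nonzero degree `d ≥ 2`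
homogeneous polynomial with nonnegative coefficients", §2.3.)

## What is here

* §1 `IsCRayleigh c f` (Def. 2.18, with the lane's `iterPderiv α = ∂^α`), its unfolding, the `α = 0` instance
  `f ∂_i∂_j f ≤ c ∂_i f ∂_j f`, monotonicity in `c`, the trivial case of degree `≤ 1`, and for `c = 1` the sign of the
  tree's Rayleigh difference `Δ_{ij}(f)(w) = ∂_i f ∂_j f - ∂_i∂_j f · f ≥ 0` on `ℝ^n_{≥0}`.
* §2 the Hessian at a point `hessianAt f w = 𝓗_f(w) = (∂_i∂_j f(w))_{ij}` and Euler's formulas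
  `Σ_j w_j 𝓗_{ij} = (d-1) ∂_i f(w)`, `w^T 𝓗 w = d(d-1) f(w)`, `w^T 𝓗 e_i = (d-1) ∂_i f(w)`; for a quadratic form
  `𝓗_q(w) = hessian q`.
* §3 **Prop. 2.17, pointwise** (`eval_mul_hessianAt_le`): if `w ∈ ℝ^n_{≥0}` and `𝓗_f(w)` has at most one positive
  eigenvalue then `f(w) ∂_i∂_j f(w) ≤ 2(1 - 1/d) ∂_i f(w) ∂_j f(w)` — the printed proof verbatim (reverse Cauchy–Schwarz on
  the plane `⟨w, e_i + t e_j⟩`, drop the nonnegative `∂_i² f`, `∂_j² f` terms, discriminant in `t`).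
* §4 **Prop. 2.19 in degree `2`** (`isCRayleigh_one_of_mem_lorentzian_two`): every `q ∈ L^2_n` is `1 = 2(1 - 1/2)`-Rayleigh
  (its Hessian is constant, so Prop. 2.17 applies at every `w ≥ 0` without Theorem 2.16; the cases `α ≠ 0` of Def. 2.18
  are trivial in degree `2`), and `rayleighDiff_eval_nonneg_of_mem_lorentzian_two`.
* §5 **Prop. 2.19 in every degree, conditionally on Thm. 2.16 (2)**: Prop. 2.17 on the CLOSED orthant from the printed
  hypothesis on the open orthant (`eval_mul_eval_pderiv_pderiv_le_of_forall_pos`, continuity along `w + ε𝟙`), and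
  `isCRayleigh_of_forall_sigPos_hessianAt_iterPderiv_le_one` / `isCRayleigh_of_mem_lorentzian_of_forall_sigPos_le_one`:
  if every `𝓗_{∂^α f}(w)`, `|α| + 2 ≤ d`, `w ∈ ℝ^n_{>0}`, has at most one positive eigenvalue (Thm. 2.16 (2) for the
  Lorentzian `∂^α f`), then `f` is `2(1 - 1/d)`-Rayleigh — the printed proof of Prop. 2.19.

One definition with body (`IsCRayleigh`) and one (`hessianAt`); theorems otherwise; no `sorry`, no named fact. The
Hodge–Riemann relations Thm. 2.16 (2) themselves are not in the tree; §5 isolates them as the only missing input of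
Prop. 2.19 in degree `d ≥ 3`. -- TODO(general form): Thm. 2.16 (2), making §5 unconditional.

## References

* [BrandenHuh2019] P. Brändén, J. Huh, *Lorentzian polynomials*, Ann. of Math. (2) 192 (2020) 821–891, arXiv:1902.03719 —
  §2.3 Prop. 2.17, §2.4 Def. 2.18, Prop. 2.19.
* [Branden2007] P. Brändén, *Polynomials with the half-plane property and matroid theory*, Adv. Math. 216 (2007) — §5
  (`Δ_{ij}`), via `Literature.Combinatorics.StablePolynomials.rayleighDiff`.
-/

noncomputable section

open MvPolynomial Finsupp Finset Matrix
open Literature.Combinatorics.StablePolynomials Literature.LinearAlgebra.QuadraticForm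

namespace Literature.Combinatorics.LorentzianPolynomials

variable {σ : Type*} [Fintype σ]

/-! ## §1 `c`-Rayleigh polynomials (Def. 2.18) -/

section Def

/-- **`c`-Rayleigh polynomial** (Brändén–Huh Def. 2.18): `f ∈ ℝ[w_1,…,w_n]` (not necessarily homogeneous) is `c`-Rayleigh
if it has nonnegative coefficients and `∂^α f(w) · ∂^{α+e_i+e_j} f(w) ≤ c · ∂^{α+e_i} f(w) · ∂^{α+e_j} f(w)` for all
`i, j ∈ [n]`, `α ∈ ℕ^n` and `w ∈ ℝ^n_{≥0}` (here `∂^α = iterPderiv α`). [cite: BrandenHuh2019, §2.4 Def. 2.18] -/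
def IsCRayleigh (c : ℝ) (f : MvPolynomial σ ℝ) : Prop :=
  (∀ α, 0 ≤ coeff α f) ∧ ∀ (α : σ →₀ ℕ) (i j : σ) (w : σ → ℝ), (∀ k, 0 ≤ w k) →
    eval w (iterPderiv α f) * eval w (iterPderiv (α + Finsupp.single i 1 + Finsupp.single j 1) f) ≤
      c * (eval w (iterPderiv (α + Finsupp.single i 1) f) * eval w (iterPderiv (α + Finsupp.single j 1) f))

/-- Unfolding Def. 2.18. [cite: BrandenHuh2019, §2.4 Def. 2.18] -/
theorem isCRayleigh_iff (c : ℝ) (f : MvPolynomial σ ℝ) :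
    IsCRayleigh c f ↔ (∀ α, 0 ≤ coeff α f) ∧ ∀ (α : σ →₀ ℕ) (i j : σ) (w : σ → ℝ), (∀ k, 0 ≤ w k) →
      eval w (iterPderiv α f) * eval w (iterPderiv (α + Finsupp.single i 1 + Finsupp.single j 1) f) ≤
        c * (eval w (iterPderiv (α + Finsupp.single i 1) f) * eval w (iterPderiv (α + Finsupp.single j 1) f)) :=
  Iff.rfl

/-- A `c`-Rayleigh polynomial has nonnegative coefficients. [cite: BrandenHuh2019, §2.4 Def. 2.18] -/
theorem IsCRayleigh.coeff_nonneg {c : ℝ} {f : MvPolynomial σ ℝ} (h : IsCRayleigh c f) (α : σ →₀ ℕ) : 0 ≤ coeff α f :=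
  h.1 α

/-- The defining inequality of a `c`-Rayleigh polynomial. [cite: BrandenHuh2019, §2.4 Def. 2.18] -/
theorem IsCRayleigh.le {c : ℝ} {f : MvPolynomial σ ℝ} (h : IsCRayleigh c f) (α : σ →₀ ℕ) (i j : σ) {w : σ → ℝ}
    (hw : ∀ k, 0 ≤ w k) :
    eval w (iterPderiv α f) * eval w (iterPderiv (α + Finsupp.single i 1 + Finsupp.single j 1) f) ≤
      c * (eval w (iterPderiv (α + Finsupp.single i 1) f) * eval w (iterPderiv (α + Finsupp.single j 1) f)) :=
  h.2 α i j w hw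

/-- `∂^{e_i + e_j} f = ∂_i ∂_j f`. [cite: BrandenHuh2019, §2.1 (p. 8, "`∂^α = ∂_1^{α_1} ⋯ ∂_n^{α_n}`")] -/
theorem iterPderiv_single_add_single (i j : σ) (f : MvPolynomial σ ℝ) :
    iterPderiv (Finsupp.single i 1 + Finsupp.single j 1) f = pderiv j (pderiv i f) := by
  rw [iterPderiv_add_single, iterPderiv_single]

/-- The partial derivatives commute: `∂_i ∂_j f = ∂_j ∂_i f`. [cite: BrandenHuh2019, §2.1 (p. 8, "the symmetric matrix")] -/
theorem pderiv_pderiv_comm (i j : σ) (f : MvPolynomial σ ℝ) : pderiv i (pderiv j f) = pderiv j (pderiv i f) := by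
  rw [← iterPderiv_single_add_single, ← iterPderiv_single_add_single, add_comm]

/-- **The case `α = 0` of Def. 2.18**: `f(w) ∂_i∂_j f(w) ≤ c ∂_i f(w) ∂_j f(w)` on `ℝ^n_{≥0}` ("when `f` is multi-affine
[…] the `c`-Rayleigh condition for `f` is equivalent to" this with `i ≠ j`). [cite: BrandenHuh2019, §2.4 Def. 2.18] -/
theorem IsCRayleigh.eval_mul_eval_pderiv_pderiv_le {c : ℝ} {f : MvPolynomial σ ℝ} (h : IsCRayleigh c f) (i j : σ)
    {w : σ → ℝ} (hw : ∀ k, 0 ≤ w k) :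
    eval w f * eval w (pderiv i (pderiv j f)) ≤ c * (eval w (pderiv i f) * eval w (pderiv j f)) := by
  have h0 := h.le 0 i j hw
  rwa [zero_add, zero_add, iterPderiv_zero, iterPderiv_single, iterPderiv_single, iterPderiv_single_add_single,
    pderiv_pderiv_comm] at h0

omit [Fintype σ] in
/-- Evaluations of `∂^α f` on `ℝ^n_{≥0}` are nonnegative when `f` has nonnegative coefficients.
[cite: BrandenHuh2019, §2.4 Def. 2.18 ("`f` has nonnegative coefficients")] -/
theorem eval_iterPderiv_nonneg [Fintype σ] {f : MvPolynomial σ ℝ} (hnn : ∀ α, 0 ≤ coeff α f) (α : σ →₀ ℕ) {w : σ → ℝ}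
    (hw : ∀ k, 0 ≤ w k) : 0 ≤ eval w (iterPderiv α f) :=
  eval_nonneg_of_coeff_nonneg (fun β ↦ coeff_iterPderiv_nonneg hnn α β) hw

/-- **Monotonicity in `c`** ("because `2(1 - 1/d)` is an increasing function of `d`"): a `c`-Rayleigh polynomial is
`c'`-Rayleigh for every `c' ≥ c`. [cite: BrandenHuh2019, §2.4 proof of Prop. 2.19] -/
theorem IsCRayleigh.mono {c c' : ℝ} {f : MvPolynomial σ ℝ} (h : IsCRayleigh c f) (hcc' : c ≤ c') : IsCRayleigh c' f :=
  ⟨h.1, fun α i j _ hw ↦ (h.le α i j hw).trans (mul_le_mul_of_nonneg_right hcc'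
    (mul_nonneg (eval_iterPderiv_nonneg h.1 _ hw) (eval_iterPderiv_nonneg h.1 _ hw)))⟩

/-- `∂^α f = 0` when `|α|` exceeds the degree of the homogeneous polynomial `f`.
[cite: BrandenHuh2019, §2.1 (p. 8, "`∂^α = ∂_1^{α_1} ⋯ ∂_n^{α_n}`")] -/
theorem iterPderiv_eq_zero_of_lt {f : MvPolynomial σ ℝ} {d : ℕ} (hf : f.IsHomogeneous d) {α : σ →₀ ℕ}
    (h : d < α.degree) : iterPderiv α f = 0 := by
  ext β
  rw [coeff_iterPderiv, coeff_zero, hf.coeff_eq_zero, mul_zero]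
  rw [map_add]
  omega

/-- **Prop. 2.19 in degree `≤ 1`** (trivially): a homogeneous polynomial of degree `≤ 1` with nonnegative coefficients
is `c`-Rayleigh for every `c ≥ 0` — all the second derivatives `∂^{α+e_i+e_j} f` vanish.
[cite: BrandenHuh2019, §2.4 Prop. 2.19 (`d ≤ 1`)] -/
theorem isCRayleigh_of_isHomogeneous_of_le_one {f : MvPolynomial σ ℝ} {d : ℕ} (hf : f.IsHomogeneous d) (hd : d ≤ 1)
    (hnn : ∀ α, 0 ≤ coeff α f) {c : ℝ} (hc : 0 ≤ c) : IsCRayleigh c f := by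
  refine ⟨hnn, fun α i j w hw ↦ ?_⟩
  rw [iterPderiv_eq_zero_of_lt hf (α := α + Finsupp.single i 1 + Finsupp.single j 1)
    (by rw [map_add, map_add, Finsupp.degree_single, Finsupp.degree_single]; omega),
    map_zero, mul_zero]
  exact mul_nonneg hc (mul_nonneg (eval_iterPderiv_nonneg hnn _ hw) (eval_iterPderiv_nonneg hnn _ hw))

/-- **`1`-Rayleigh in Brändén's notation**: for a `1`-Rayleigh `f`, the Rayleigh difference
`Δ_{ij}(f) = ∂_i f ∂_j f - ∂_i∂_j f · f` (the tree's `rayleighDiff`) is nonnegative on `ℝ^n_{≥0}` ("the `1`-Rayleigh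
property of multi-affine polynomials is equivalent to the Rayleigh property […] studied in [Wagner08] and [BBL]").
[cite: BrandenHuh2019, §2.4 Def. 2.18 (the paragraph after it)] -/
theorem IsCRayleigh.rayleighDiff_eval_nonneg {f : MvPolynomial σ ℝ} (h : IsCRayleigh 1 f) (i j : σ) {w : σ → ℝ}
    (hw : ∀ k, 0 ≤ w k) : 0 ≤ eval w (rayleighDiff i j f) := by
  have h0 := h.eval_mul_eval_pderiv_pderiv_le i j hw
  rw [one_mul] at h0
  rw [rayleighDiff, map_sub, map_mul, map_mul, sub_nonneg, mul_comm (eval w (pderiv i (pderiv j f)))]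
  exact h0

end Def

/-! ## §2 The Hessian at a point and Euler's formulas -/

section HessianAt

/-- **The Hessian of `f` at the point `w`**: `𝓗_f(w) = (∂_i∂_j f(w))_{i,j}`. [cite: BrandenHuh2019, §2.1 (p. 8,
"`𝓗_f(w) = (∂_i∂_j f)_{i,j=1}^n`"); §2.3 Prop. 2.17] -/
def hessianAt (f : MvPolynomial σ ℝ) (w : σ → ℝ) : Matrix σ σ ℝ := Matrix.of fun i j ↦ eval w (pderiv i (pderiv j f))

omit [Fintype σ] in
/-- `𝓗_f(w)_{ij} = ∂_i∂_j f(w)`. [cite: BrandenHuh2019, §2.1 (p. 8)] -/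
theorem hessianAt_apply (f : MvPolynomial σ ℝ) (w : σ → ℝ) (i j : σ) :
    hessianAt f w i j = eval w (pderiv i (pderiv j f)) := rfl

/-- `𝓗_f(w)` is symmetric. [cite: BrandenHuh2019, §2.1 (p. 8, "the symmetric matrix")] -/
theorem hessianAt_comm (f : MvPolynomial σ ℝ) (w : σ → ℝ) (i j : σ) : hessianAt f w i j = hessianAt f w j i := by
  rw [hessianAt_apply, hessianAt_apply, pderiv_pderiv_comm]

/-- `𝓗_f(w)` is a symmetric matrix. [cite: BrandenHuh2019, §2.1 (p. 8, "the symmetric matrix")] -/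
theorem isSymm_hessianAt (f : MvPolynomial σ ℝ) (w : σ → ℝ) : (hessianAt f w).IsSymm :=
  Matrix.IsSymm.ext fun i j ↦ hessianAt_comm f w j i

omit [Fintype σ] in
/-- `𝓗_f(w)` has nonnegative entries for `w ∈ ℝ^n_{≥0}` when `f` has nonnegative coefficients.
[cite: BrandenHuh2019, §2.3 proof of Prop. 2.17 (dropping "`d(d-1) f (∂_i^2 f + t^2 ∂_j^2 f)`")] -/
theorem hessianAt_nonneg {f : MvPolynomial σ ℝ} (hnn : ∀ α, 0 ≤ coeff α f) {w : σ → ℝ} (hw : ∀ k, 0 ≤ w k) (i j : σ) :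
    0 ≤ hessianAt f w i j :=
  eval_nonneg_of_coeff_nonneg (coeff_pderiv_nonneg (coeff_pderiv_nonneg hnn j) i) hw

/-- **Euler's formula, evaluated**: `Σ_i w_i ∂_i f(w) = d · f(w)` for `f` homogeneous of degree `d`.
[cite: BrandenHuh2019, §2.3 proof of Lemma 2.15 ("Euler's formula for homogeneous functions: `d f = Σ w_i ∂_i f`")] -/
theorem sum_mul_eval_pderiv {f : MvPolynomial σ ℝ} {d : ℕ} (hf : f.IsHomogeneous d) (w : σ → ℝ) :
    ∑ i, w i * eval w (pderiv i f) = d * eval w f := by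
  have h := congrArg (eval w) hf.sum_X_mul_pderiv
  rw [map_sum, map_nsmul, nsmul_eq_mul] at h
  rw [← h]
  exact Finset.sum_congr rfl fun i _ ↦ by rw [map_mul, eval_X]

/-- **Euler for the Hessian rows**: `Σ_j 𝓗_f(w)_{ij} w_j = (d-1) ∂_i f(w)`.
[cite: BrandenHuh2019, §2.3 proof of Prop. 2.17 ("`w^T 𝓗 e_i = (d-1) ∂_i f(w)`")] -/
theorem sum_hessianAt_mul {f : MvPolynomial σ ℝ} {d : ℕ} (hf : f.IsHomogeneous d) (w : σ → ℝ) (i : σ) :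
    ∑ j, hessianAt f w i j * w j = ((d - 1 : ℕ) : ℝ) * eval w (pderiv i f) := by
  rw [← sum_mul_eval_pderiv (hf.pderiv (i := i)) w]
  exact Finset.sum_congr rfl fun j _ ↦ by rw [hessianAt_apply, pderiv_pderiv_comm, mul_comm]

omit [Fintype σ] in
/-- **For a quadratic form the Hessian is constant**: `𝓗_q(w) = hessian q` for every `w`.
[cite: BrandenHuh2019, §2.1 (p. 8, "the symmetric matrix"); §2.4 Prop. 2.19 (`d = 2`)] -/
theorem hessianAt_eq_hessian {q : MvPolynomial σ ℝ} (hq : q.IsHomogeneous 2) (w : σ → ℝ) : hessianAt q w = hessian q := by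
  ext i j
  have h0 : (pderiv i (pderiv j q)).IsHomogeneous 0 := by simpa using (hq.pderiv (i := j)).pderiv (i := i)
  rw [hessianAt_apply, hessian_apply, totalDegree_eq_zero_iff_eq_C.1 (Nat.le_zero.1 h0.totalDegree_le), eval_C, coeff_zero_C]

variable [DecidableEq σ]

/-- `uᵀ𝓗_f(w)v = Σ_{i,j} 𝓗_{ij} u_i v_j`. [cite: BrandenHuh2019, §2.3 proof of Prop. 2.17 ("`w^T 𝓗 v_t`")] -/
theorem toBilin'_hessianAt_apply (f : MvPolynomial σ ℝ) (w u v : σ → ℝ) :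
    Matrix.toBilin' (hessianAt f w) u v = ∑ i, ∑ j, hessianAt f w i j * u i * v j := by
  rw [Matrix.toBilin'_apply]
  exact Finset.sum_congr rfl fun i _ ↦ Finset.sum_congr rfl fun j _ ↦ by ring

/-- `(u, v) ↦ uᵀ𝓗_f(w)v` is symmetric. [cite: BrandenHuh2019, §2.1 (p. 8, "the symmetric matrix")] -/
theorem isSymm_toBilin'_hessianAt (f : MvPolynomial σ ℝ) (w : σ → ℝ) : LinearMap.IsSymm (Matrix.toBilin' (hessianAt f w)) :=
  ⟨fun u v ↦ by
    rw [Matrix.toBilin'_apply', Matrix.toBilin'_apply', Matrix.dotProduct_mulVec, ← Matrix.mulVec_transpose,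
      (isSymm_hessianAt f w).eq, dotProduct_comm, RingHom.id_apply]⟩

/-- **`w^T 𝓗 e_i = (d-1) ∂_i f(w)`**. [cite: BrandenHuh2019, §2.3 proof of Prop. 2.17] -/
theorem toBilin'_hessianAt_self_single {f : MvPolynomial σ ℝ} {d : ℕ} (hf : f.IsHomogeneous d) (w : σ → ℝ) (i : σ) :
    Matrix.toBilin' (hessianAt f w) w (Pi.single i 1) = ((d - 1 : ℕ) : ℝ) * eval w (pderiv i f) := by
  rw [← sum_hessianAt_mul hf w i, toBilin'_hessianAt_apply]
  refine Finset.sum_congr rfl fun a _ ↦ ?_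
  rw [Finset.sum_eq_single i (fun b _ hb ↦ by rw [Pi.single_eq_of_ne hb, mul_zero]) (fun h ↦ (h (mem_univ i)).elim),
    Pi.single_eq_same, mul_one, hessianAt_comm, mul_comm]

/-- **`w^T 𝓗 w = d(d-1) f(w)`**. [cite: BrandenHuh2019, §2.3 proof of Prop. 2.17] -/
theorem toBilin'_hessianAt_self {f : MvPolynomial σ ℝ} {d : ℕ} (hf : f.IsHomogeneous d) (w : σ → ℝ) :
    Matrix.toBilin' (hessianAt f w) w w = d * ((d - 1 : ℕ) : ℝ) * eval w f := by
  rw [toBilin'_hessianAt_apply]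
  calc ∑ i, ∑ j, hessianAt f w i j * w i * w j = ∑ i, w i * (((d - 1 : ℕ) : ℝ) * eval w (pderiv i f)) := by
        refine Finset.sum_congr rfl fun i _ ↦ ?_
        rw [← sum_hessianAt_mul hf w i, Finset.mul_sum]
        exact Finset.sum_congr rfl fun j _ ↦ by ring
    _ = ((d - 1 : ℕ) : ℝ) * ∑ i, w i * eval w (pderiv i f) := by
        rw [Finset.mul_sum]; exact Finset.sum_congr rfl fun i _ ↦ by ring
    _ = d * ((d - 1 : ℕ) : ℝ) * eval w f := by rw [sum_mul_eval_pderiv hf]; ring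

/-- `v_t^T 𝓗 v_t = 𝓗_{ii} + 2t 𝓗_{ij} + t² 𝓗_{jj}` for `v_t = e_i + t e_j`.
[cite: BrandenHuh2019, §2.3 proof of Prop. 2.17 ("`∂_i^2 f + 2t ∂_i∂_j f + t^2 ∂_j^2 f`")] -/
theorem toBilin'_hessianAt_single_add_smul_single (f : MvPolynomial σ ℝ) (w : σ → ℝ) (i j : σ) (t : ℝ) :
    Matrix.toBilin' (hessianAt f w) (Pi.single i 1 + t • Pi.single j 1) (Pi.single i 1 + t • Pi.single j 1) =
      hessianAt f w i i + 2 * t * hessianAt f w i j + t ^ 2 * hessianAt f w j j := by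
  have hs : ∀ a b : σ, Matrix.toBilin' (hessianAt f w) (Pi.single a 1) (Pi.single b 1) = hessianAt f w a b :=
    fun a b ↦ by rw [Matrix.toBilin'_apply']; simp
  simp only [map_add, map_smul, LinearMap.add_apply, LinearMap.smul_apply, smul_eq_mul, hs, hessianAt_comm f w j i]
  ring

/-- `w^T 𝓗 v_t = (d-1)(∂_i f(w) + t ∂_j f(w))` for `v_t = e_i + t e_j`.
[cite: BrandenHuh2019, §2.3 proof of Prop. 2.17 ("`(d-1)^2 (∂_i f + t ∂_j f)^2`")] -/
theorem toBilin'_hessianAt_self_single_add_smul_single {f : MvPolynomial σ ℝ} {d : ℕ} (hf : f.IsHomogeneous d)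
    (w : σ → ℝ) (i j : σ) (t : ℝ) :
    Matrix.toBilin' (hessianAt f w) w (Pi.single i 1 + t • Pi.single j 1) =
      ((d - 1 : ℕ) : ℝ) * (eval w (pderiv i f) + t * eval w (pderiv j f)) := by
  rw [map_add, map_smul, toBilin'_hessianAt_self_single hf, toBilin'_hessianAt_self_single hf, smul_eq_mul]
  ring

end HessianAt

/-! ## §3 Proposition 2.17, pointwise -/

section RayleighLemma

variable [DecidableEq σ]

/-- **Brändén–Huh Prop. 2.17 (pointwise form).** Let `f` be homogeneous of degree `d ≥ 2` with nonnegative coefficients,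
`w ∈ ℝ^n_{≥0}`, and suppose `𝓗_f(w)` has at most one positive eigenvalue. Then
`f(w) ∂_i∂_j f(w) ≤ 2(1 - 1/d) ∂_i f(w) ∂_j f(w)` for all `i, j`. (Printed with the hypothesis "`𝓗_f(w)` has exactly one
positive eigenvalue for all `w ∈ ℝ^n_{>0}`" and the conclusion on `ℝ^n_{≥0}`; the proof — Euler's formulas, the reverse
Cauchy–Schwarz inequality on the plane `⟨w, e_i + t e_j⟩`, dropping `d(d-1) f (∂_i² f + t² ∂_j² f) ≥ 0`, and the
discriminant in `t` — uses only the signature at the point `w`.) [cite: BrandenHuh2019, §2.3 Prop. 2.17] -/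
theorem eval_mul_hessianAt_le {f : MvPolynomial σ ℝ} {d : ℕ} (hf : f.IsHomogeneous d) (hd : 2 ≤ d)
    (hnn : ∀ α, 0 ≤ coeff α f) {w : σ → ℝ} (hw : ∀ k, 0 ≤ w k)
    (h1 : sigPos (Matrix.toBilin' (hessianAt f w)).toQuadraticMap ≤ 1) (i j : σ) :
    eval w f * hessianAt f w i j ≤ 2 * (1 - 1 / (d : ℝ)) * (eval w (pderiv i f) * eval w (pderiv j f)) := by
  have hd1 : ((d - 1 : ℕ) : ℝ) = d - 1 := by rw [Nat.cast_sub (by omega : 1 ≤ d), Nat.cast_one]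
  have hdpos : (0 : ℝ) < d := by exact_mod_cast (show 0 < d by omega)
  have hd2 : (2 : ℝ) ≤ d := by exact_mod_cast hd
  have hd1pos : (0 : ℝ) < d - 1 := by linarith
  have hF0 : 0 ≤ eval w f := eval_nonneg_of_coeff_nonneg hnn hw
  have ha0 : 0 ≤ eval w (pderiv i f) := eval_nonneg_of_coeff_nonneg (coeff_pderiv_nonneg hnn i) hw
  have hb0 : 0 ≤ eval w (pderiv j f) := eval_nonneg_of_coeff_nonneg (coeff_pderiv_nonneg hnn j) hw
  have hii := hessianAt_nonneg hnn hw i i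
  have hjj := hessianAt_nonneg hnn hw j j
  -- `w^T 𝓗 w = d(d-1) f(w) ≥ 0`
  have hww : Matrix.toBilin' (hessianAt f w) w w = d * (d - 1) * eval w f := by rw [toBilin'_hessianAt_self hf, hd1]
  have hww0 : 0 ≤ Matrix.toBilin' (hessianAt f w) w w := by
    rw [hww]; exact mul_nonneg (mul_nonneg hdpos.le hd1pos.le) hF0
  -- names for the five real numbers in play
  set F := eval w f with hF
  set a := eval w (pderiv i f) with ha
  set b := eval w (pderiv j f) with hb
  set H := hessianAt f w i j with hH
  -- reverse Cauchy–Schwarz on the plane `⟨w, v_t⟩` for every real `t`, minus the nonnegative `d(d-1) F (𝓗_ii + t² 𝓗_jj)`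
  have key : ∀ t : ℝ, 0 ≤ (d - 1) ^ 2 * b ^ 2 * (t * t) +
      (2 * (d - 1) ^ 2 * a * b - 2 * d * (d - 1) * F * H) * t + (d - 1) ^ 2 * a ^ 2 := by
    intro t
    have h := mul_le_sq_of_sigPos_le_one (Matrix.toBilin' (hessianAt f w)) (isSymm_toBilin'_hessianAt f w) h1
      (Pi.single i 1 + t • Pi.single j 1) w hww0
    rw [hww, toBilin'_hessianAt_single_add_smul_single, ← (isSymm_toBilin'_hessianAt f w).eq, RingHom.id_apply,
      toBilin'_hessianAt_self_single_add_smul_single hf, hd1] at h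
    have hdrop : 0 ≤ d * (d - 1) * F * (hessianAt f w i i + t ^ 2 * hessianAt f w j j) :=
      mul_nonneg (mul_nonneg (mul_nonneg hdpos.le hd1pos.le) hF0) (add_nonneg hii (mul_nonneg (sq_nonneg t) hjj))
    nlinarith [h, hdrop]
  -- the discriminant in `t` is nonpositive: `|(d-1)² ab - d(d-1) F H| ≤ (d-1)² ab`
  have hdisc := discrim_le_zero key
  rw [discrim] at hdisc
  have hY : 0 ≤ (d - 1) ^ 2 * a * b := mul_nonneg (mul_nonneg (sq_nonneg _) ha0) hb0
  have hsq : ((d - 1) ^ 2 * a * b - d * (d - 1) * F * H) ^ 2 ≤ ((d - 1) ^ 2 * a * b) ^ 2 := by nlinarith [hdisc]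
  have hlin : d * (d - 1) * F * H ≤ 2 * ((d - 1) ^ 2 * a * b) := by
    have habs := abs_le_of_sq_le_sq' hsq hY
    linarith [habs.1]
  -- divide by `d - 1 > 0` and by `d > 0`
  have h3 : d * (F * H) - 2 * (d - 1) * (a * b) ≤ 0 := by
    by_contra hcon
    have hpos : 0 < (d - 1) * (d * (F * H) - 2 * (d - 1) * (a * b)) := mul_pos hd1pos (lt_of_not_ge hcon)
    nlinarith [hlin, hpos]
  have h4 : F * H ≤ 2 * (d - 1) * (a * b) / d := by
    rw [le_div_iff₀ hdpos]; linarith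
  have h5 : (1 - 1 / (d : ℝ)) * d = d - 1 := by
    rw [sub_mul, one_mul, one_div, inv_mul_cancel₀ hdpos.ne']
  calc F * H ≤ 2 * (d - 1) * (a * b) / d := h4
    _ = 2 * (1 - 1 / (d : ℝ)) * (a * b) := by
        rw [eq_comm, eq_div_iff hdpos.ne']
        calc 2 * (1 - 1 / (d : ℝ)) * (a * b) * d = 2 * ((1 - 1 / (d : ℝ)) * d) * (a * b) := by ring
          _ = 2 * (d - 1) * (a * b) := by rw [h5]

/-- Prop. 2.17, pointwise, in `∂_i∂_j` notation: `f(w) ∂_i∂_j f(w) ≤ 2(1 - 1/d) ∂_i f(w) ∂_j f(w)`.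
[cite: BrandenHuh2019, §2.3 Prop. 2.17] -/
theorem eval_mul_eval_pderiv_pderiv_le {f : MvPolynomial σ ℝ} {d : ℕ} (hf : f.IsHomogeneous d) (hd : 2 ≤ d)
    (hnn : ∀ α, 0 ≤ coeff α f) {w : σ → ℝ} (hw : ∀ k, 0 ≤ w k)
    (h1 : sigPos (Matrix.toBilin' (hessianAt f w)).toQuadraticMap ≤ 1) (i j : σ) :
    eval w f * eval w (pderiv i (pderiv j f)) ≤ 2 * (1 - 1 / (d : ℝ)) * (eval w (pderiv i f) * eval w (pderiv j f)) :=
  eval_mul_hessianAt_le hf hd hnn hw h1 i j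

end RayleighLemma

/-! ## §4 Proposition 2.19 in degree two: Lorentzian quadratic forms are `1`-Rayleigh -/

section DegreeTwo

variable [DecidableEq σ]

/-- For a Lorentzian quadratic form, `𝓗_q(w) = hessian q` has at most one positive eigenvalue at every point.
[cite: BrandenHuh2019, §2.2 Def. 2.6 (`L^2_n`); §2.3 Thm. 2.16 (`d = 2`, "The base case `d = 2` is trivial")] -/
theorem sigPos_hessianAt_le_one_of_mem_lorentzian_two {q : MvPolynomial σ ℝ} (hf : q ∈ lorentzian σ 2) (w : σ → ℝ) :
    sigPos (Matrix.toBilin' (hessianAt q w)).toQuadraticMap ≤ 1 := by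
  rw [hessianAt_eq_hessian (isHomogeneous_of_mem_lorentzian hf)]
  exact (mem_lorentzian_two_iff_sigPos.1 hf).2.2

/-- **Prop. 2.17 for a Lorentzian quadratic form, on all of `ℝ^n_{≥0}`**: `q(w) ∂_i∂_j q ≤ ∂_i q(w) ∂_j q(w)`
(`2(1 - 1/2) = 1`). [cite: BrandenHuh2019, §2.3 Prop. 2.17; §2.4 Prop. 2.19 (`d = 2`)] -/
theorem eval_mul_hessian_le_of_mem_lorentzian_two {q : MvPolynomial σ ℝ} (hf : q ∈ lorentzian σ 2) {w : σ → ℝ}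
    (hw : ∀ k, 0 ≤ w k) (i j : σ) : eval w q * hessian q i j ≤ eval w (pderiv i q) * eval w (pderiv j q) := by
  have h := eval_mul_hessianAt_le (isHomogeneous_of_mem_lorentzian hf) le_rfl (coeff_nonneg_of_mem_lorentzian hf) hw
    (sigPos_hessianAt_le_one_of_mem_lorentzian_two hf w) i j
  rw [hessianAt_eq_hessian (isHomogeneous_of_mem_lorentzian hf)] at h
  norm_num at h
  exact h

/-- **Brändén–Huh Prop. 2.19 in degree `2`: every Lorentzian quadratic form is `1`-Rayleigh** (`1 = 2(1 - 1/2)`; the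
case `α = 0` of Def. 2.18 is Prop. 2.17 at every `w ≥ 0` — the Hessian of a quadratic form is constant — and for
`α ≠ 0` the factor `∂^{α+e_i+e_j} q` vanishes). [cite: BrandenHuh2019, §2.4 Prop. 2.19 (`d = 2`)] -/
theorem isCRayleigh_one_of_mem_lorentzian_two {q : MvPolynomial σ ℝ} (hf : q ∈ lorentzian σ 2) : IsCRayleigh 1 q := by
  have hq := isHomogeneous_of_mem_lorentzian hf
  have hnn := coeff_nonneg_of_mem_lorentzian hf
  refine ⟨hnn, fun α i j w hw ↦ ?_⟩
  by_cases hα : α = 0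
  · subst hα
    rw [zero_add, zero_add, iterPderiv_zero, iterPderiv_single, iterPderiv_single, iterPderiv_single_add_single,
      pderiv_pderiv_comm, one_mul]
    rw [← hessianAt_apply q w i j, hessianAt_eq_hessian hq]
    exact eval_mul_hessian_le_of_mem_lorentzian_two hf hw i j
  · have hdeg : 0 < α.degree := by
      rw [pos_iff_ne_zero, Ne, Finsupp.degree_eq_zero_iff]
      exact hα
    rw [iterPderiv_eq_zero_of_lt hq (α := α + Finsupp.single i 1 + Finsupp.single j 1)
      (by rw [map_add, map_add, Finsupp.degree_single, Finsupp.degree_single]; omega),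
      map_zero, mul_zero, one_mul]
    exact mul_nonneg (eval_iterPderiv_nonneg hnn _ hw) (eval_iterPderiv_nonneg hnn _ hw)

/-- Prop. 2.19 in degree `2`, printed constant: every `q ∈ L^2_n` is `2(1 - 1/2)`-Rayleigh.
[cite: BrandenHuh2019, §2.4 Prop. 2.19 (`d = 2`)] -/
theorem isCRayleigh_of_mem_lorentzian_two {q : MvPolynomial σ ℝ} (hf : q ∈ lorentzian σ 2) :
    IsCRayleigh (2 * (1 - 1 / (2 : ℝ))) q := by
  norm_num
  exact isCRayleigh_one_of_mem_lorentzian_two hf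

/-- Prop. 2.19 in degree `≤ 1`: every `f ∈ L^d_n`, `d ≤ 1`, is `c`-Rayleigh for all `c ≥ 0` (in particular
`2(1 - 1/d)`-Rayleigh). [cite: BrandenHuh2019, §2.4 Prop. 2.19 (`d ≤ 1`)] -/
theorem isCRayleigh_of_mem_lorentzian_of_le_one {f : MvPolynomial σ ℝ} {d : ℕ} (hf : f ∈ lorentzian σ d) (hd : d ≤ 1)
    {c : ℝ} (hc : 0 ≤ c) : IsCRayleigh c f :=
  isCRayleigh_of_isHomogeneous_of_le_one (isHomogeneous_of_mem_lorentzian hf) hd (coeff_nonneg_of_mem_lorentzian hf) hc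

/-- **The Rayleigh difference of a Lorentzian quadratic form is nonnegative on `ℝ^n_{≥0}`**:
`Δ_{ij}(q)(w) = ∂_i q ∂_j q - ∂_i∂_j q · q ≥ 0` (Brändén's `Δ_{ij}`, the tree's `rayleighDiff`).
[cite: BrandenHuh2019, §2.4 Prop. 2.19 (`d = 2`) with Def. 2.18 (the paragraph after it)] -/
theorem rayleighDiff_eval_nonneg_of_mem_lorentzian_two {q : MvPolynomial σ ℝ} (hf : q ∈ lorentzian σ 2) (i j : σ)
    {w : σ → ℝ} (hw : ∀ k, 0 ≤ w k) : 0 ≤ eval w (rayleighDiff i j q) :=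
  (isCRayleigh_one_of_mem_lorentzian_two hf).rayleighDiff_eval_nonneg i j hw

end DegreeTwo

/-! ## §5 Proposition 2.19 in every degree, conditionally on the Hodge–Riemann relations (Thm. 2.16 (2)) -/

section Conditional

variable [DecidableEq σ]

/-- **Prop. 2.17 on the closed orthant.** If `𝓗_f(w)` has at most one positive eigenvalue for all `w ∈ ℝ^n_{>0}` (the
printed hypothesis), then `f(w) ∂_i∂_j f(w) ≤ 2(1 - 1/d) ∂_i f(w) ∂_j f(w)` for all `w ∈ ℝ^n_{≥0}` — the boundary points by
continuity along `w + ε𝟙`, `ε → 0⁺` (both sides are polynomial in `w`). [cite: BrandenHuh2019, §2.3 Prop. 2.17] -/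
theorem eval_mul_eval_pderiv_pderiv_le_of_forall_pos {f : MvPolynomial σ ℝ} {d : ℕ} (hf : f.IsHomogeneous d) (hd : 2 ≤ d)
    (hnn : ∀ α, 0 ≤ coeff α f)
    (h1 : ∀ w : σ → ℝ, (∀ k, 0 < w k) → sigPos (Matrix.toBilin' (hessianAt f w)).toQuadraticMap ≤ 1)
    {w : σ → ℝ} (hw : ∀ k, 0 ≤ w k) (i j : σ) :
    eval w f * eval w (pderiv i (pderiv j f)) ≤ 2 * (1 - 1 / (d : ℝ)) * (eval w (pderiv i f) * eval w (pderiv j f)) := by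
  -- both sides along `w + ε𝟙`, as continuous functions of `ε`
  let L : ℝ → ℝ := fun ε ↦ eval (fun k ↦ w k + ε) f * eval (fun k ↦ w k + ε) (pderiv i (pderiv j f))
  let R : ℝ → ℝ := fun ε ↦ 2 * (1 - 1 / (d : ℝ)) * (eval (fun k ↦ w k + ε) (pderiv i f) * eval (fun k ↦ w k + ε) (pderiv j f))
  have hpath : Continuous fun ε : ℝ ↦ (fun k : σ ↦ w k + ε) := continuous_pi fun k ↦ continuous_const.add continuous_id
  have hL : Continuous L :=
    ((MvPolynomial.continuous_eval f).comp hpath).mul ((MvPolynomial.continuous_eval (pderiv i (pderiv j f))).comp hpath)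
  have hR : Continuous R :=
    continuous_const.mul (((MvPolynomial.continuous_eval (pderiv i f)).comp hpath).mul ((MvPolynomial.continuous_eval (pderiv j f)).comp hpath))
  have hle : ∀ ε, 0 < ε → L ε ≤ R ε := fun ε hε ↦
    eval_mul_hessianAt_le hf hd hnn (w := fun k ↦ w k + ε) (fun k ↦ by linarith [hw k])
      (h1 _ fun k ↦ by linarith [hw k]) i j
  have hev : ∀ᶠ ε in nhdsWithin (0 : ℝ) (Set.Ioi 0), L ε ≤ R ε := eventually_nhdsWithin_of_forall fun ε hε ↦ hle ε hε
  have hLt : Filter.Tendsto L (nhdsWithin 0 (Set.Ioi 0)) (nhds (L 0)) := (hL.tendsto 0).mono_left nhdsWithin_le_nhds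
  have hRt : Filter.Tendsto R (nhdsWithin 0 (Set.Ioi 0)) (nhds (R 0)) := (hR.tendsto 0).mono_left nhdsWithin_le_nhds
  have key : L 0 ≤ R 0 := le_of_tendsto_of_tendsto hLt hRt hev
  simpa [L, R] using key

/-- `2(1 - 1/m) ≤ 2(1 - 1/d)` for `0 < m ≤ d` ("`2(1 - 1/d)` is an increasing function of `d`").
[cite: BrandenHuh2019, §2.4 proof of Prop. 2.19] -/
theorem two_mul_one_sub_inv_mono {m d : ℕ} (hm : 0 < m) (hmd : m ≤ d) :
    2 * (1 - 1 / (m : ℝ)) ≤ 2 * (1 - 1 / (d : ℝ)) := by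
  have hm' : (0 : ℝ) < m := by exact_mod_cast hm
  have hmd' : (m : ℝ) ≤ d := by exact_mod_cast hmd
  have h : 1 / (d : ℝ) ≤ 1 / (m : ℝ) := one_div_le_one_div_of_le hm' hmd'
  linarith

/-- `0 ≤ 2(1 - 1/d)` for every natural `d` (with `1/0 = 0`). [cite: BrandenHuh2019, §2.4 Prop. 2.19] -/
theorem two_mul_one_sub_inv_nonneg (d : ℕ) : (0 : ℝ) ≤ 2 * (1 - 1 / (d : ℝ)) := by
  rcases Nat.eq_zero_or_pos d with h | h
  · simp [h]
  · have h1 : (1 : ℝ) ≤ d := by exact_mod_cast h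
    have : 1 / (d : ℝ) ≤ 1 := (div_le_one (by linarith)).2 h1
    linarith

/-- **Brändén–Huh Prop. 2.19, conditionally on Thm. 2.16 (2).** Let `f` be homogeneous of degree `d` with nonnegative
coefficients (e.g. `f ∈ L^d_n`) and suppose that for every `α` with `|α| + 2 ≤ d` and every `w ∈ ℝ^n_{>0}` the Hessian
`𝓗_{∂^α f}(w)` has at most one positive eigenvalue — for `f ∈ L^d_n` this is the Hodge–Riemann relation Thm. 2.16 (2)
applied to the Lorentzian polynomials `∂^α f ∈ L^{d-|α|}_n`, which is not yet in the tree. Then `f` is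
`2(1 - 1/d)`-Rayleigh: "The statement follows from Theorem 2.16 and Proposition 2.17 because `2(1 - 1/d)` is an
increasing function of `d`." [cite: BrandenHuh2019, §2.4 Prop. 2.19 (proof)] -/
theorem isCRayleigh_of_forall_sigPos_hessianAt_iterPderiv_le_one {f : MvPolynomial σ ℝ} {d : ℕ} (hf : f.IsHomogeneous d)
    (hnn : ∀ α, 0 ≤ coeff α f)
    (hHR : ∀ α : σ →₀ ℕ, α.degree + 2 ≤ d → ∀ w : σ → ℝ, (∀ k, 0 < w k) →
      sigPos (Matrix.toBilin' (hessianAt (iterPderiv α f) w)).toQuadraticMap ≤ 1) :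
    IsCRayleigh (2 * (1 - 1 / (d : ℝ))) f := by
  refine ⟨hnn, fun α i j w hw ↦ ?_⟩
  have hnnα : ∀ β, 0 ≤ coeff β (iterPderiv α f) := fun β ↦ coeff_iterPderiv_nonneg hnn α β
  by_cases hk : α.degree + 2 ≤ d
  · -- `∂^α f` is homogeneous of degree `m = d - |α| ≥ 2`: Prop. 2.17 for it, then monotonicity of `2(1 - 1/m)` in `m`
    obtain ⟨m, hm⟩ : ∃ m, d = m + α.degree := ⟨d - α.degree, by omega⟩
    have hm2 : 2 ≤ m := by omega
    have hmd : m ≤ d := by omega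
    have hf' : f.IsHomogeneous (m + α.degree) := hm ▸ hf
    have hg : (iterPderiv α f).IsHomogeneous m := IsHomogeneous.iterPderiv α hf'
    have h := eval_mul_eval_pderiv_pderiv_le_of_forall_pos hg hm2 hnnα (hHR α hk) hw i j
    rw [iterPderiv_add_single (α + Finsupp.single i 1) j f, iterPderiv_add_single α i f, iterPderiv_add_single α j f,
      pderiv_pderiv_comm j i]
    exact h.trans (mul_le_mul_of_nonneg_right (two_mul_one_sub_inv_mono (by omega) hmd)
      (mul_nonneg (eval_nonneg_of_coeff_nonneg (coeff_pderiv_nonneg hnnα i) hw)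
        (eval_nonneg_of_coeff_nonneg (coeff_pderiv_nonneg hnnα j) hw)))
  · -- `|α| + 2 > d`: the second derivative `∂^{α+e_i+e_j} f` vanishes
    have hzero : iterPderiv (α + Finsupp.single i 1 + Finsupp.single j 1) f = 0 :=
      iterPderiv_eq_zero_of_lt hf (by rw [map_add, map_add, Finsupp.degree_single, Finsupp.degree_single]; omega)
    rw [hzero, map_zero, mul_zero]
    exact mul_nonneg (two_mul_one_sub_inv_nonneg d)
      (mul_nonneg (eval_iterPderiv_nonneg hnn _ hw) (eval_iterPderiv_nonneg hnn _ hw))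

/-- **Prop. 2.19 for `f ∈ L^d_n`, conditionally on Thm. 2.16 (2)** for the `∂^α f`: "Any polynomial in `L^d_n` is
`2(1 - 1/d)`-Rayleigh" once the Hessians `𝓗_{∂^α f}(w)`, `w ∈ ℝ^n_{>0}`, `|α| ≤ d - 2`, have at most one positive
eigenvalue. (Unconditional for `d ≤ 2`: `isCRayleigh_of_mem_lorentzian_two`, `isCRayleigh_of_mem_lorentzian_of_le_one`.)
[cite: BrandenHuh2019, §2.4 Prop. 2.19; §2.3 Thm. 2.16 (2)] -/
theorem isCRayleigh_of_mem_lorentzian_of_forall_sigPos_le_one {f : MvPolynomial σ ℝ} {d : ℕ} (hf : f ∈ lorentzian σ d)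
    (hHR : ∀ α : σ →₀ ℕ, α.degree + 2 ≤ d → ∀ w : σ → ℝ, (∀ k, 0 < w k) →
      sigPos (Matrix.toBilin' (hessianAt (iterPderiv α f) w)).toQuadraticMap ≤ 1) :
    IsCRayleigh (2 * (1 - 1 / (d : ℝ))) f :=
  isCRayleigh_of_forall_sigPos_hessianAt_iterPderiv_le_one (isHomogeneous_of_mem_lorentzian hf)
    (coeff_nonneg_of_mem_lorentzian hf) hHR

end Conditional

end Literature.Combinatorics.LorentzianPolynomials

end
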